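import Literature.Probability.LatticeModels.DobrushinDiscretisation
import Literature.Probability.RandomPlanarGeometry.PlanarDomains
import Mathlib.Topology.MetricSpace.HausdorffDistance
import HarnessLib

/-!
# The discrete marked edges of a discretisation family stay near the marked points

Topic: `Summits/CriticalPhenomena/CardyFormulaZ2`. For the crux `LagHandOff` (line
hitting-tournament, boundary kernel): for a discretisation family `E` of the Dobrushin domain
`(D; a, b)`, the field `ZdDiscretisationFamily.tendsto_zdABEdges` (Hausdorff convergence of the
midpoints of the `A`–`B` edges to `{a, b}`) gives, for every `ε > 0` and all small meshes `δ > 0`,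
that the midpoint of every `A`–`B` edge of `E δ` is within `ε` of `a = D.pt 0` or of `b = D.pt 1`.
-/

noncomputable section

open MeasureTheory Filter Set Topology
open Literature.Probability.Percolation Literature.Probability.LatticeModels
open Literature.Probability.RandomPlanarGeometry

namespace Summit.CriticalPhenomena.CardyFormulaZ2.Cruxes.LagHandOff.HittingTournament

/-- Near a two-point set in the Hausdorff sense, every point of `s` is within `ε` of `x` or of
`y`. -/
theorem dist_lt_or_dist_lt_of_hausdorffEDist_pair_lt {s : Set ℂ} {x y : ℂ} {ε : ℝ}
    (h : Metric.hausdorffEDist s {x, y} < ENNReal.ofReal ε) {z : ℂ} (hz : z ∈ s) :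
    dist z x < ε ∨ dist z y < ε := by
  have h1 : Metric.infEDist z {x, y} < ENNReal.ofReal ε :=
    (Metric.infEDist_le_hausdorffEDist_of_mem hz).trans_lt h
  obtain ⟨w, hw, hzw⟩ := Metric.infEDist_lt_iff.1 h1
  rw [edist_lt_ofReal] at hzw
  rcases hw with rfl | rfl
  · exact Or.inl hzw
  · exact Or.inr (by simpa using hzw)

/-- **The discrete marked edges stay near the marked points.** For a discretisation family `E`
of the Dobrushin domain `(D; a, b)` and every `ε > 0`, for all small meshes `δ > 0` the midpoint
`medialPoint δ e` of every `A`–`B` edge `e ∈ (E δ).zdABEdges` is within `ε` of `a = D.pt 0` or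
of `b = D.pt 1` (from the Hausdorff convergence `ZdDiscretisationFamily.tendsto_zdABEdges`). -/
theorem stub_kernel_zdABEdges_near_marks :
    ∀ (D : DobrushinDomain) (E : ℝ → DiscreteDobrushin), ZdDiscretisationFamily D E →
      ∀ ε : ℝ, 0 < ε → ∀ᶠ δ in 𝓝[>] (0 : ℝ), ∀ e ∈ (E δ).zdABEdges,
        dist (medialPoint δ e) (D.pt 0) < ε ∨ dist (medialPoint δ e) (D.pt 1) < ε := by
  intro D E hE ε hε
  have h0 : (0 : ENNReal) < ENNReal.ofReal ε := ENNReal.ofReal_pos.2 hε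
  have hev : ∀ᶠ δ in 𝓝[>] (0 : ℝ),
      Metric.hausdorffEDist (medialPoint δ '' (E δ).zdABEdges) {D.pt 0, D.pt 1} <
        ENNReal.ofReal ε :=
    hE.tendsto_zdABEdges (Iio_mem_nhds h0)
  filter_upwards [hev] with δ hδ e he
  exact dist_lt_or_dist_lt_of_hausdorffEDist_pair_lt hδ (Set.mem_image_of_mem _ he)

end Summit.CriticalPhenomena.CardyFormulaZ2.Cruxes.LagHandOff.HittingTournament

end
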